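import Mathlib

/-!
# Imbrie (2016), Assumption LLA: the dressed two-level gap `√(ℓ² + γ²Γ²)` has a bounded density, uniformly in `γ`

CITATION HEADER (lean-in-tree rule 2026-08-18). J. Z. Imbrie, *On many-body localization for quantum spin chains*,
J. Stat. Phys. **163** (2016) 998–1048, doi 10.1007/s10955-016-1508-x, arXiv:1403.7837 [ImbrieJSP2016], eq. (1.1) (the transverse
couplings `γ Γ_i` are RANDOM with a bounded density, §1: "we need the γ_i's to be random for the proof [of non-degeneracy]"), eq. (1.3)
(Assumption LLA(ν, C): P(min gap < δ) ≤ Cⁿ δ^ν).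

WHAT IS PROVED (a lemma of the audit cell `pub-imbrie`, LLA.md gen-5 J8(c), NOT a statement of the paper).  A single resonant site of (1.1)
with local field `ℓ` and transverse coupling `c = γΓ` is the 2×2 block `[[ℓ, c], [c, −ℓ]]`, whose level gap is `2r`, `r = √(ℓ² + c²)` (the
"dressed gap").  With `ℓ` FROZEN couplings the map `ℓ ↦ r` folds at `ℓ = 0` and the law of `r` has the density `≍ (r − γ|Γ|)^{-1/2}`, which is
in L¹ but not in L^∞ — the source of the logarithmic excess in the two-fold small-gap probability for FIXED couplings (LLA.md J8(b)).  This file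
proves that averaging over the random transverse coupling removes the fold singularity UNIFORMLY IN γ: for `0 ≤ a`, `0 < η`, `0 < γ`,
  `Leb {(c, ℓ) : |c| ≤ γ, a ≤ √(c² + ℓ²) ≤ a + η} ≤ 32 γ η`            (`volume_dressedGapWindow_le`),
by three regimes — `γ ≤ η` (two boxes), `η < γ, 2γ < a` (Fubini in `c`, sections of length ≤ 4η: `volume_sq_mem_Icc_le`,
`volume_dressedGap_section_le`), `η < γ, a ≤ 2γ` (difference of two discs, scaling of Lebesgue measure: `volume_disc_eq`, `volume_unitDisc_le`).
Consequently, if `c` has a law with density ≤ κ and `ℓ` an independent law with density ≤ ρ (`measure_dressedGapWindow_le`), the window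
probability is ≤ κ ρ · 32 γ η; for `c = γ Γ` with `Γ` of density ≤ ρ₀ on `[−1, 1]` one has κ = ρ₀/γ (`map_mul_left_le_smul_volume`) and the
bound is `32 ρ₀² η` with NO γ (`prod_dressedGapWindow_le`): the dressed gap of one resonant site has a density bounded uniformly in the small
coupling γ, which quantifies Imbrie's §1 remark that the Γ_i must be random; and for two independent such sites (Fubini)
`P(|r₁ − r₂| < δ) ≤ 64 ρ₀² δ` (`twoSite_dressedGaps_close_le`) — exponent ν = 1 with no logarithm, in contrast with FROZEN couplings (LLA.md J8(b)).  What this file does NOT do: treat blocks of several resonant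
sites with unfrozen intermediate spins (the open residue (PND_r)/(M5) of LLA.md); it says NOTHING about whether LLA holds (OPEN).
No `sorry`, no new axioms, no definitions.
-/

namespace Literature.MathematicalPhysics.QuantumLattice.Imbrie2016

open MeasureTheory Set
open scoped Pointwise

/-- One-dimensional shell: `Leb {ℓ : A ≤ ℓ² ≤ B} ≤ 2 (√B − √A)` for `0 ≤ A` (two intervals `±[√A, √B]`).
[cite: ImbrieJSP2016, eq. (1.1), (1.3); cell lemma pub-imbrie LLA.md J8(c)] -/
theorem volume_sq_mem_Icc_le {A B : ℝ} (hA : 0 ≤ A) :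
    volume {ℓ : ℝ | A ≤ ℓ ^ 2 ∧ ℓ ^ 2 ≤ B} ≤ ENNReal.ofReal (2 * (Real.sqrt B - Real.sqrt A)) := by
  have hsub : {ℓ : ℝ | A ≤ ℓ ^ 2 ∧ ℓ ^ 2 ≤ B} ⊆
      Icc (Real.sqrt A) (Real.sqrt B) ∪ Icc (-Real.sqrt B) (-Real.sqrt A) := by
    intro ℓ hℓ
    rcases hℓ with ⟨h1, h2⟩
    have hlo : Real.sqrt A ≤ |ℓ| := by
      rw [← Real.sqrt_sq_eq_abs]; exact Real.sqrt_le_sqrt h1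
    have hhi : |ℓ| ≤ Real.sqrt B := by
      rw [← Real.sqrt_sq_eq_abs]; exact Real.sqrt_le_sqrt h2
    rcases le_or_gt 0 ℓ with hℓ0 | hℓ0
    · left
      rw [abs_of_nonneg hℓ0] at hlo hhi
      exact ⟨hlo, hhi⟩
    · right
      rw [abs_of_neg hℓ0] at hlo hhi
      constructor <;> linarith
  have hA' := hA
  calc volume {ℓ : ℝ | A ≤ ℓ ^ 2 ∧ ℓ ^ 2 ≤ B}
      ≤ volume (Icc (Real.sqrt A) (Real.sqrt B) ∪ Icc (-Real.sqrt B) (-Real.sqrt A)) := measure_mono hsub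
    _ ≤ volume (Icc (Real.sqrt A) (Real.sqrt B)) + volume (Icc (-Real.sqrt B) (-Real.sqrt A)) :=
        measure_union_le _ _
    _ = ENNReal.ofReal (Real.sqrt B - Real.sqrt A) + ENNReal.ofReal (Real.sqrt B - Real.sqrt A) := by
        rw [Real.volume_Icc, Real.volume_Icc]
        congr 2
        ring
    _ ≤ ENNReal.ofReal (2 * (Real.sqrt B - Real.sqrt A)) := by
        rcases le_or_gt 0 (Real.sqrt B - Real.sqrt A) with h | h
        · rw [← ENNReal.ofReal_add h h]
          apply le_of_eq; congr 1; ring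
        · rw [ENNReal.ofReal_of_nonpos h.le]
          simp

/-- The elementary inequality `√(x² + y²) ≤ |x| + |y|`. [folklore] -/
theorem sqrt_sq_add_sq_le_abs_add_abs (x y : ℝ) : Real.sqrt (x ^ 2 + y ^ 2) ≤ |x| + |y| := by
  rw [Real.sqrt_le_iff]
  refine ⟨by positivity, ?_⟩
  nlinarith [abs_nonneg x, abs_nonneg y, sq_abs x, sq_abs y]

/-- Section bound (regime `η < γ`, `2γ < a`): for a frozen transverse coupling `|c| ≤ γ` the set of local fields `ℓ` with dressed gap
`√(c² + ℓ²) ∈ [a, a + η]` has Lebesgue measure ≤ 4η.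
[cite: ImbrieJSP2016, eq. (1.1), (1.3); cell lemma pub-imbrie LLA.md J8(c)] -/
theorem volume_dressedGap_section_le {γ a η c : ℝ} (hη : 0 < η) (hηγ : η < γ) (ha : 2 * γ < a)
    (hc : |c| ≤ γ) :
    volume {ℓ : ℝ | a ≤ Real.sqrt (c ^ 2 + ℓ ^ 2) ∧ Real.sqrt (c ^ 2 + ℓ ^ 2) ≤ a + η}
      ≤ ENNReal.ofReal (4 * η) := by
  have hγ : 0 < γ := lt_of_lt_of_le (hη.trans hηγ) le_rfl
  have ha0 : 0 < a := by linarith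
  have hc2 : c ^ 2 ≤ γ ^ 2 := by
    rw [← sq_abs]; exact pow_le_pow_left₀ (abs_nonneg c) hc 2
  set A := a ^ 2 - c ^ 2 with hAdef
  set B := (a + η) ^ 2 - c ^ 2 with hBdef
  have hA34 : (3 * a / 4) ^ 2 ≤ A := by rw [hAdef]; nlinarith
  have hA0 : 0 ≤ A := le_trans (sq_nonneg _) hA34
  have hAB : A ≤ B := by rw [hAdef, hBdef]; nlinarith
  have hB0 : 0 ≤ B := hA0.trans hAB
  have hsub : {ℓ : ℝ | a ≤ Real.sqrt (c ^ 2 + ℓ ^ 2) ∧ Real.sqrt (c ^ 2 + ℓ ^ 2) ≤ a + η} ⊆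
      {ℓ : ℝ | A ≤ ℓ ^ 2 ∧ ℓ ^ 2 ≤ B} := by
    intro ℓ hℓ
    rcases hℓ with ⟨h1, h2⟩
    have h1' : a ^ 2 ≤ c ^ 2 + ℓ ^ 2 := (Real.le_sqrt ha0.le (by positivity)).1 h1
    have h2' : c ^ 2 + ℓ ^ 2 ≤ (a + η) ^ 2 := (Real.sqrt_le_left (by linarith)).1 h2
    constructor
    · rw [hAdef]; linarith
    · rw [hBdef]; linarith
  have hs : 3 * a / 4 ≤ Real.sqrt A := (Real.le_sqrt (by positivity) hA0).2 hA34
  have ht : Real.sqrt A ≤ Real.sqrt B := Real.sqrt_le_sqrt hAB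
  have hsq : Real.sqrt B ^ 2 - Real.sqrt A ^ 2 = 2 * a * η + η ^ 2 := by
    rw [Real.sq_sqrt hB0, Real.sq_sqrt hA0, hAdef, hBdef]; ring
  have hdiff : Real.sqrt B - Real.sqrt A ≤ 2 * η := by
    by_contra hcon
    push Not at hcon
    have hpos : 0 ≤ Real.sqrt B - Real.sqrt A := by linarith
    have hsum : 3 * a / 2 ≤ Real.sqrt B + Real.sqrt A := by linarith
    have hprod : 2 * η * (3 * a / 2) ≤ (Real.sqrt B - Real.sqrt A) * (Real.sqrt B + Real.sqrt A) :=
      mul_le_mul hcon.le hsum (by positivity) hpos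
    have hexp : (Real.sqrt B - Real.sqrt A) * (Real.sqrt B + Real.sqrt A) = 2 * a * η + η ^ 2 := by
      rw [← hsq]; ring
    rw [hexp] at hprod
    nlinarith
  calc volume {ℓ : ℝ | a ≤ Real.sqrt (c ^ 2 + ℓ ^ 2) ∧ Real.sqrt (c ^ 2 + ℓ ^ 2) ≤ a + η}
      ≤ volume {ℓ : ℝ | A ≤ ℓ ^ 2 ∧ ℓ ^ 2 ≤ B} := measure_mono hsub
    _ ≤ ENNReal.ofReal (2 * (Real.sqrt B - Real.sqrt A)) := volume_sq_mem_Icc_le hA0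
    _ ≤ ENNReal.ofReal (4 * η) := ENNReal.ofReal_le_ofReal (by linarith)

/-- Scaling of discs: `{q : ℝ × ℝ | q.1² + q.2² ≤ r²} = r • {q | q.1² + q.2² ≤ 1}` for `0 < r`. [folklore] -/
theorem disc_eq_smul_unitDisc {r : ℝ} (hr : 0 < r) :
    {q : ℝ × ℝ | q.1 ^ 2 + q.2 ^ 2 ≤ r ^ 2} = r • {q : ℝ × ℝ | q.1 ^ 2 + q.2 ^ 2 ≤ 1} := by
  ext q
  rw [Set.mem_smul_set_iff_inv_smul_mem₀ hr.ne']
  simp only [mem_setOf_eq, Prod.smul_fst, Prod.smul_snd, smul_eq_mul]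
  have hr2 : 0 < r ^ 2 := by positivity
  have key : (r⁻¹ * q.1) ^ 2 + (r⁻¹ * q.2) ^ 2 = (q.1 ^ 2 + q.2 ^ 2) / r ^ 2 := by
    field_simp
  rw [key, div_le_one hr2]

/-- Area of a disc by scaling: `Leb {q.1² + q.2² ≤ r²} = r² · Leb(unit disc)` for `0 < r`. [folklore] -/
theorem volume_disc_eq {r : ℝ} (hr : 0 < r) :
    volume {q : ℝ × ℝ | q.1 ^ 2 + q.2 ^ 2 ≤ r ^ 2}
      = ENNReal.ofReal (r ^ 2) * volume {q : ℝ × ℝ | q.1 ^ 2 + q.2 ^ 2 ≤ 1} := by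
  rw [disc_eq_smul_unitDisc hr, Measure.addHaar_smul_of_nonneg volume hr.le]
  congr 2
  simp [Module.finrank_prod]

/-- The unit disc sits in the square `[−1,1]²`, so its area is at most 4 (we never need π). [folklore] -/
theorem volume_unitDisc_le : volume {q : ℝ × ℝ | q.1 ^ 2 + q.2 ^ 2 ≤ 1} ≤ 4 := by
  have hsub : {q : ℝ × ℝ | q.1 ^ 2 + q.2 ^ 2 ≤ 1} ⊆ Icc (-1 : ℝ) 1 ×ˢ Icc (-1 : ℝ) 1 := by
    intro q hq
    simp only [mem_setOf_eq] at hq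
    have h1 : q.1 ^ 2 ≤ 1 := by nlinarith [sq_nonneg q.2]
    have h2 : q.2 ^ 2 ≤ 1 := by nlinarith [sq_nonneg q.1]
    rw [sq_le_one_iff_abs_le_one] at h1 h2
    exact ⟨abs_le.1 h1, abs_le.1 h2⟩
  calc volume {q : ℝ × ℝ | q.1 ^ 2 + q.2 ^ 2 ≤ 1}
      ≤ volume (Icc (-1 : ℝ) 1 ×ˢ Icc (-1 : ℝ) 1) := measure_mono hsub
    _ = volume (Icc (-1 : ℝ) 1) * volume (Icc (-1 : ℝ) 1) := by
        rw [Measure.volume_eq_prod, Measure.prod_prod]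
    _ = 4 := by
        rw [Real.volume_Icc]
        rw [← ENNReal.ofReal_mul (by norm_num)]
        have : ((1 : ℝ) - -1) * (1 - -1) = 4 := by norm_num
        rw [this]
        simp

/-- MAIN VOLUME LEMMA.  For `0 < γ`, `0 ≤ a`, `0 < η`:
`Leb {(c, ℓ) ∈ ℝ² : |c| ≤ γ, a ≤ √(c² + ℓ²) ≤ a + η} ≤ 32 γ η` — the dressed gap window has measure linear in its width `η`, with a
constant proportional to the width `γ` of the transverse-coupling strip and otherwise absolute (uniform in the window position `a`).
[cite: ImbrieJSP2016, eq. (1.1), (1.3), §1; cell lemma pub-imbrie LLA.md J8(c)] -/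
theorem volume_dressedGapWindow_le {γ a η : ℝ} (hγ : 0 < γ) (ha : 0 ≤ a) (hη : 0 < η) :
    volume {q : ℝ × ℝ | |q.1| ≤ γ ∧ a ≤ Real.sqrt (q.1 ^ 2 + q.2 ^ 2) ∧ Real.sqrt (q.1 ^ 2 + q.2 ^ 2) ≤ a + η}
      ≤ ENNReal.ofReal (32 * γ * η) := by
  set S := {q : ℝ × ℝ | |q.1| ≤ γ ∧ a ≤ Real.sqrt (q.1 ^ 2 + q.2 ^ 2) ∧ Real.sqrt (q.1 ^ 2 + q.2 ^ 2) ≤ a + η}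
    with hSdef
  rcases le_or_gt γ η with hγη | hηγ
  · -- Regime 1: `γ ≤ η`, two boxes.
    have hsub : S ⊆ Icc (-γ) γ ×ˢ (Icc (-(a + η)) (-(a - γ)) ∪ Icc (a - γ) (a + η)) := by
      intro q hq
      rcases hq with ⟨h1, h2, h3⟩
      have hup : |q.2| ≤ a + η := by
        calc |q.2| = Real.sqrt (q.2 ^ 2) := (Real.sqrt_sq_eq_abs _).symm
          _ ≤ Real.sqrt (q.1 ^ 2 + q.2 ^ 2) := Real.sqrt_le_sqrt (by nlinarith [sq_nonneg q.1])
          _ ≤ a + η := h3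
      have hlow : a - γ ≤ |q.2| := by
        have := sqrt_sq_add_sq_le_abs_add_abs q.1 q.2
        linarith
      refine ⟨abs_le.1 h1, ?_⟩
      rcases le_or_gt 0 q.2 with hq0 | hq0
      · right
        rw [abs_of_nonneg hq0] at hup hlow
        exact ⟨hlow, hup⟩
      · left
        rw [abs_of_neg hq0] at hup hlow
        constructor <;> linarith
    calc volume S ≤ volume (Icc (-γ) γ ×ˢ (Icc (-(a + η)) (-(a - γ)) ∪ Icc (a - γ) (a + η))) := measure_mono hsub
      _ = volume (Icc (-γ) γ) * volume (Icc (-(a + η)) (-(a - γ)) ∪ Icc (a - γ) (a + η)) := by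
          rw [Measure.volume_eq_prod, Measure.prod_prod]
      _ ≤ volume (Icc (-γ) γ) * (volume (Icc (-(a + η)) (-(a - γ))) + volume (Icc (a - γ) (a + η))) := by
          gcongr; exact measure_union_le _ _
      _ = ENNReal.ofReal (2 * γ) * (ENNReal.ofReal (η + γ) + ENNReal.ofReal (η + γ)) := by
          rw [Real.volume_Icc, Real.volume_Icc, Real.volume_Icc]
          congr 2
          · ring
          · congr 1; ring
          · congr 1; ring
      _ = ENNReal.ofReal (2 * γ * (2 * (η + γ))) := by
          rw [← ENNReal.ofReal_add (by linarith) (by linarith), ← ENNReal.ofReal_mul (by linarith)]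
          congr 1; ring
      _ ≤ ENNReal.ofReal (32 * γ * η) := ENNReal.ofReal_le_ofReal (by nlinarith)
  rcases lt_or_ge (2 * γ) a with hγa | haγ
  · -- Regime 2: `η < γ`, `2γ < a`: Fubini in `c`, sections of length ≤ 4η.
    have hS : MeasurableSet S := by
      have hcont : Continuous fun q : ℝ × ℝ => Real.sqrt (q.1 ^ 2 + q.2 ^ 2) := by fun_prop
      have h1 : IsClosed {q : ℝ × ℝ | |q.1| ≤ γ} := isClosed_le (by fun_prop) continuous_const
      have h2 : IsClosed {q : ℝ × ℝ | a ≤ Real.sqrt (q.1 ^ 2 + q.2 ^ 2)} := isClosed_le continuous_const hcont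
      have h3 : IsClosed {q : ℝ × ℝ | Real.sqrt (q.1 ^ 2 + q.2 ^ 2) ≤ a + η} := isClosed_le hcont continuous_const
      have : S = {q : ℝ × ℝ | |q.1| ≤ γ} ∩ ({q : ℝ × ℝ | a ≤ Real.sqrt (q.1 ^ 2 + q.2 ^ 2)} ∩
          {q : ℝ × ℝ | Real.sqrt (q.1 ^ 2 + q.2 ^ 2) ≤ a + η}) := by
        ext q; simp [hSdef]
      rw [this]
      exact h1.measurableSet.inter (h2.measurableSet.inter h3.measurableSet)
    rw [Measure.volume_eq_prod, Measure.prod_apply hS]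
    have hpt : ∀ c : ℝ, volume (Prod.mk c ⁻¹' S) ≤ (Icc (-γ) γ).indicator (fun _ => ENNReal.ofReal (4 * η)) c := by
      intro c
      by_cases hc : |c| ≤ γ
      · have hmem : c ∈ Icc (-γ) γ := abs_le.1 hc
        rw [indicator_of_mem hmem]
        have : Prod.mk c ⁻¹' S = {ℓ : ℝ | a ≤ Real.sqrt (c ^ 2 + ℓ ^ 2) ∧ Real.sqrt (c ^ 2 + ℓ ^ 2) ≤ a + η} := by
          ext ℓ; simp [hSdef, hc]
        rw [this]
        exact volume_dressedGap_section_le hη hηγ hγa hc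
      · have : Prod.mk c ⁻¹' S = ∅ := by
          ext ℓ; simp [hSdef, hc]
        rw [this, measure_empty]
        exact bot_le
    calc ∫⁻ c, volume (Prod.mk c ⁻¹' S) ∂volume
        ≤ ∫⁻ c, (Icc (-γ) γ).indicator (fun _ => ENNReal.ofReal (4 * η)) c ∂volume := lintegral_mono hpt
      _ = ENNReal.ofReal (4 * η) * volume (Icc (-γ) γ) := lintegral_indicator_const measurableSet_Icc _
      _ = ENNReal.ofReal (4 * η * (2 * γ)) := by
          rw [Real.volume_Icc, ← ENNReal.ofReal_mul (by linarith)]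
          congr 1; ring
      _ ≤ ENNReal.ofReal (32 * γ * η) := ENNReal.ofReal_le_ofReal (by nlinarith)
  · -- Regime 3: `η < γ`, `a ≤ 2γ`: difference of two discs.
    set D : ℝ → Set (ℝ × ℝ) := fun r => {q : ℝ × ℝ | q.1 ^ 2 + q.2 ^ 2 ≤ r ^ 2} with hDdef
    have hU := volume_unitDisc_le
    have hDvol : ∀ r : ℝ, 0 < r → volume (D r) ≤ ENNReal.ofReal (4 * r ^ 2) := by
      intro r hr
      calc volume (D r) = ENNReal.ofReal (r ^ 2) * volume {q : ℝ × ℝ | q.1 ^ 2 + q.2 ^ 2 ≤ 1} := volume_disc_eq hr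
        _ ≤ ENNReal.ofReal (r ^ 2) * 4 := by gcongr
        _ = ENNReal.ofReal (4 * r ^ 2) := by
            rw [show (4 : ENNReal) = ENNReal.ofReal 4 by simp, ← ENNReal.ofReal_mul (sq_nonneg _)]
            congr 1; ring
    have hSout : S ⊆ D (a + η) := by
      intro q hq
      rcases hq with ⟨_, _, h3⟩
      exact (Real.sqrt_le_left (by linarith)).1 h3
    rcases le_or_gt a η with haη | hηa
    · -- `a ≤ η`: the outer disc alone suffices.
      calc volume S ≤ volume (D (a + η)) := measure_mono hSout
        _ ≤ ENNReal.ofReal (4 * (a + η) ^ 2) := hDvol _ (by linarith)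
        _ ≤ ENNReal.ofReal (32 * γ * η) := ENNReal.ofReal_le_ofReal (by nlinarith)
    · -- `η < a ≤ 2γ`: `S ∪ D(a−η) ⊆ D(a+η)` disjointly.
      have hin : 0 < a - η := by linarith
      have hdisj : Disjoint S (D (a - η)) := by
        rw [Set.disjoint_left]
        intro q hq hqD
        rcases hq with ⟨_, h2, _⟩
        have h2' : a ^ 2 ≤ q.1 ^ 2 + q.2 ^ 2 := (Real.le_sqrt ha (by positivity)).1 h2
        have hqD' : q.1 ^ 2 + q.2 ^ 2 ≤ (a - η) ^ 2 := hqD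
        nlinarith
      have hDmeas : MeasurableSet (D (a - η)) := by
        have : IsClosed (D (a - η)) := isClosed_le (by fun_prop) continuous_const
        exact this.measurableSet
      have hunion : volume S + volume (D (a - η)) ≤ volume (D (a + η)) := by
        rw [← measure_union hdisj hDmeas]
        apply measure_mono
        apply union_subset hSout
        intro q hq
        have hq' : q.1 ^ 2 + q.2 ^ 2 ≤ (a - η) ^ 2 := hq
        show q.1 ^ 2 + q.2 ^ 2 ≤ (a + η) ^ 2
        nlinarith
      have hfin : volume (D (a - η)) ≠ ⊤ :=
        ne_top_of_le_ne_top ENNReal.ofReal_ne_top (hDvol _ hin)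
      have hinner : volume (D (a - η)) = ENNReal.ofReal ((a - η) ^ 2) * volume {q : ℝ × ℝ | q.1 ^ 2 + q.2 ^ 2 ≤ 1} :=
        volume_disc_eq hin
      have houter : volume (D (a + η)) = ENNReal.ofReal ((a + η) ^ 2) * volume {q : ℝ × ℝ | q.1 ^ 2 + q.2 ^ 2 ≤ 1} :=
        volume_disc_eq (by linarith)
      have hUfin : volume {q : ℝ × ℝ | q.1 ^ 2 + q.2 ^ 2 ≤ 1} ≠ ⊤ :=
        ne_top_of_le_ne_top (by simp) hU
      calc volume S ≤ volume (D (a + η)) - volume (D (a - η)) := ENNReal.le_sub_of_add_le_right hfin hunion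
        _ = (ENNReal.ofReal ((a + η) ^ 2) - ENNReal.ofReal ((a - η) ^ 2)) *
              volume {q : ℝ × ℝ | q.1 ^ 2 + q.2 ^ 2 ≤ 1} := by
            rw [houter, hinner, ENNReal.sub_mul (fun _ _ => hUfin)]
        _ = ENNReal.ofReal ((a + η) ^ 2 - (a - η) ^ 2) * volume {q : ℝ × ℝ | q.1 ^ 2 + q.2 ^ 2 ≤ 1} := by
            rw [ENNReal.ofReal_sub _ (sq_nonneg _)]
        _ ≤ ENNReal.ofReal ((a + η) ^ 2 - (a - η) ^ 2) * 4 := by gcongr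
        _ = ENNReal.ofReal (16 * a * η) := by
            rw [show (4 : ENNReal) = ENNReal.ofReal 4 by simp, ← ENNReal.ofReal_mul (by nlinarith)]
            congr 1; ring
        _ ≤ ENNReal.ofReal (32 * γ * η) := ENNReal.ofReal_le_ofReal (by nlinarith)

/-- PROBABILISTIC FORM.  If the transverse coupling `c` has a law `μc` with density ≤ κ and the local field `ℓ` an independent law `μl`
with density ≤ ρ, the dressed gap `√(c² + ℓ²)` falls in a window `[a, a + η]` (with `|c| ≤ γ`) with probability ≤ κ ρ · 32 γ η.
[cite: ImbrieJSP2016, eq. (1.1), (1.3), §1; cell lemma pub-imbrie LLA.md J8(c)] -/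
theorem measure_dressedGapWindow_le {μc μl : Measure ℝ} {κ ρ γ a η : ℝ} (hκ : 0 ≤ κ) (hρ : 0 ≤ ρ)
    (hμc : μc ≤ ENNReal.ofReal κ • volume) (hμl : μl ≤ ENNReal.ofReal ρ • volume)
    (hγ : 0 < γ) (ha : 0 ≤ a) (hη : 0 < η) :
    μc.prod μl {q : ℝ × ℝ | |q.1| ≤ γ ∧ a ≤ Real.sqrt (q.1 ^ 2 + q.2 ^ 2) ∧ Real.sqrt (q.1 ^ 2 + q.2 ^ 2) ≤ a + η}
      ≤ ENNReal.ofReal (κ * ρ * (32 * γ * η)) := by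
  set S := {q : ℝ × ℝ | |q.1| ≤ γ ∧ a ≤ Real.sqrt (q.1 ^ 2 + q.2 ^ 2) ∧ Real.sqrt (q.1 ^ 2 + q.2 ^ 2) ≤ a + η}
    with hSdef
  calc μc.prod μl S ≤ (ENNReal.ofReal κ • (volume : Measure ℝ)).prod (ENNReal.ofReal ρ • (volume : Measure ℝ)) S :=
        Measure.le_iff'.1 (Measure.prod_mono hμc hμl) S
    _ = ENNReal.ofReal κ * (ENNReal.ofReal ρ * volume S) := by
        rw [Measure.prod_smul_left, Measure.prod_smul_right, ← Measure.volume_eq_prod]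
        simp [Measure.smul_apply, smul_eq_mul]
    _ ≤ ENNReal.ofReal κ * (ENNReal.ofReal ρ * ENNReal.ofReal (32 * γ * η)) := by
        gcongr; exact volume_dressedGapWindow_le hγ ha hη
    _ = ENNReal.ofReal (κ * ρ * (32 * γ * η)) := by
        rw [← ENNReal.ofReal_mul hρ, ← ENNReal.ofReal_mul hκ]
        congr 1; ring

/-- The law of `γ Γ` has density ≤ ρ₀/γ when `Γ` has density ≤ ρ₀ (`0 < γ`). [folklore] -/
theorem map_mul_left_le_smul_volume {μ : Measure ℝ} {ρ₀ γ : ℝ} (hρ : 0 ≤ ρ₀) (hγ : 0 < γ)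
    (hμ : μ ≤ ENNReal.ofReal ρ₀ • volume) :
    Measure.map (fun x : ℝ => γ * x) μ ≤ ENNReal.ofReal (ρ₀ / γ) • volume := by
  have hmeas : Measurable fun x : ℝ => γ * x := measurable_const_mul γ
  calc Measure.map (fun x : ℝ => γ * x) μ ≤ Measure.map (fun x : ℝ => γ * x) (ENNReal.ofReal ρ₀ • volume) :=
        Measure.map_mono hμ hmeas
    _ = ENNReal.ofReal (ρ₀ / γ) • volume := by
        rw [Measure.map_smul, Real.map_volume_mul_left hγ.ne', smul_smul, ← ENNReal.ofReal_mul hρ,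
          abs_of_pos (inv_pos.2 hγ), div_eq_mul_inv]

/-- IMBRIE'S SINGLE RESONANT SITE.  Let `Γ` (transverse coupling, |Γ| ≤ 1 a.s.) and `ℓ` (local field) be independent with densities ≤ ρ₀,
and `0 < γ`.  Then the dressed gap `√((γΓ)² + ℓ²)` of the resonant 2×2 block of (1.1) lies in any window `[a, a + η]`, `a ≥ 0`, with
probability ≤ 32 ρ₀² η — uniformly in γ: averaging over the random Γ removes the fold of `ℓ ↦ √(ℓ² + γ²Γ²)`.
(The event is written with the a.s.-true constraint `|γΓ| ≤ γ` so that no support hypothesis on the law of Γ is needed.)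
[cite: ImbrieJSP2016, eq. (1.1), (1.3), §1 ("we need the γ_i's to be random"); cell lemma pub-imbrie LLA.md J8(c)] -/
theorem prod_dressedGapWindow_le {μΓ μl : Measure ℝ} [SFinite μΓ] [SFinite μl] {ρ₀ γ a η : ℝ} (hρ : 0 ≤ ρ₀)
    (hμΓ : μΓ ≤ ENNReal.ofReal ρ₀ • volume) (hμl : μl ≤ ENNReal.ofReal ρ₀ • volume)
    (hγ : 0 < γ) (ha : 0 ≤ a) (hη : 0 < η) :
    μΓ.prod μl {p : ℝ × ℝ | |γ * p.1| ≤ γ ∧ a ≤ Real.sqrt ((γ * p.1) ^ 2 + p.2 ^ 2) ∧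
        Real.sqrt ((γ * p.1) ^ 2 + p.2 ^ 2) ≤ a + η}
      ≤ ENNReal.ofReal (32 * ρ₀ ^ 2 * η) := by
  set S := {q : ℝ × ℝ | |q.1| ≤ γ ∧ a ≤ Real.sqrt (q.1 ^ 2 + q.2 ^ 2) ∧ Real.sqrt (q.1 ^ 2 + q.2 ^ 2) ≤ a + η}
    with hSdef
  have hS : MeasurableSet S := by
    have hcont : Continuous fun q : ℝ × ℝ => Real.sqrt (q.1 ^ 2 + q.2 ^ 2) := by fun_prop
    have h1 : IsClosed {q : ℝ × ℝ | |q.1| ≤ γ} := isClosed_le (by fun_prop) continuous_const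
    have h2 : IsClosed {q : ℝ × ℝ | a ≤ Real.sqrt (q.1 ^ 2 + q.2 ^ 2)} := isClosed_le continuous_const hcont
    have h3 : IsClosed {q : ℝ × ℝ | Real.sqrt (q.1 ^ 2 + q.2 ^ 2) ≤ a + η} := isClosed_le hcont continuous_const
    have : S = {q : ℝ × ℝ | |q.1| ≤ γ} ∩ ({q : ℝ × ℝ | a ≤ Real.sqrt (q.1 ^ 2 + q.2 ^ 2)} ∩
        {q : ℝ × ℝ | Real.sqrt (q.1 ^ 2 + q.2 ^ 2) ≤ a + η}) := by
      ext q; simp [hSdef]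
    rw [this]
    exact h1.measurableSet.inter (h2.measurableSet.inter h3.measurableSet)
  have hmeas : Measurable fun x : ℝ => γ * x := measurable_const_mul γ
  have hpre : {p : ℝ × ℝ | |γ * p.1| ≤ γ ∧ a ≤ Real.sqrt ((γ * p.1) ^ 2 + p.2 ^ 2) ∧
      Real.sqrt ((γ * p.1) ^ 2 + p.2 ^ 2) ≤ a + η} = Prod.map (fun x : ℝ => γ * x) id ⁻¹' S := by
    ext p; simp [hSdef]
  rw [hpre, ← Measure.map_apply (hmeas.prodMap measurable_id) hS,
    ← Measure.map_prod_map μΓ μl hmeas measurable_id, Measure.map_id]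
  have hκ : 0 ≤ ρ₀ / γ := div_nonneg hρ hγ.le
  calc (Measure.map (fun x : ℝ => γ * x) μΓ).prod μl S ≤ ENNReal.ofReal (ρ₀ / γ * ρ₀ * (32 * γ * η)) :=
        measure_dressedGapWindow_le hκ hρ (map_mul_left_le_smul_volume hρ hγ hμΓ) hμl hγ ha hη
    _ = ENNReal.ofReal (32 * ρ₀ ^ 2 * η) := by
        congr 1
        rw [div_mul_eq_mul_div, div_mul_eq_mul_div, div_eq_iff hγ.ne']
        ring

/-- TWO DECOUPLED RESONANT SITES (Imbrie §1 remarks that the transverse couplings γ_i must be random for the non-degeneracy used in the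
proof; this is the quantified form for two decoupled resonant sites, uniformly in γ — a paraphrase, not a statement of the paper).  Let sites i = 1, 2 carry independent transverse couplings `Γ_i` and local fields `ℓ_i`,
all four with densities ≤ ρ₀ and the laws of `(Γ_i, ℓ_i)` probability measures, and `0 < γ`, `0 < δ`.  Then the two dressed gaps
`r_i = √((γΓ_i)² + ℓ_i²)` satisfy `P( |γΓ₁| ≤ γ ∧ |r₁ − r₂| < δ ) ≤ 64 ρ₀² δ` — exponent ν = 1 and NO γ, in contrast with the logarithmic
excess for FROZEN couplings (pub-imbrie LLA.md J8(b)).  Proof: condition on site 2 (Fubini) and apply `prod_dressedGapWindow_le` to the window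
`[max(0, r₂ − δ), max(0, r₂ − δ) + 2δ]`.
[cite: ImbrieJSP2016, eq. (1.1), (1.3), §1; cell lemma pub-imbrie LLA.md J8(c)] -/
theorem twoSite_dressedGaps_close_le {μΓ₁ μl₁ μΓ₂ μl₂ : Measure ℝ} [IsProbabilityMeasure μΓ₁] [IsProbabilityMeasure μl₁]
    [IsProbabilityMeasure μΓ₂] [IsProbabilityMeasure μl₂] {ρ₀ γ δ : ℝ} (hρ : 0 ≤ ρ₀)
    (hμΓ₁ : μΓ₁ ≤ ENNReal.ofReal ρ₀ • volume) (hμl₁ : μl₁ ≤ ENNReal.ofReal ρ₀ • volume)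
    (hγ : 0 < γ) (hδ : 0 < δ) :
    (μΓ₁.prod μl₁).prod (μΓ₂.prod μl₂)
        {x : (ℝ × ℝ) × (ℝ × ℝ) | |γ * x.1.1| ≤ γ ∧
          |Real.sqrt ((γ * x.1.1) ^ 2 + x.1.2 ^ 2) - Real.sqrt ((γ * x.2.1) ^ 2 + x.2.2 ^ 2)| < δ}
      ≤ ENNReal.ofReal (64 * ρ₀ ^ 2 * δ) := by
  set E := {x : (ℝ × ℝ) × (ℝ × ℝ) | |γ * x.1.1| ≤ γ ∧
      |Real.sqrt ((γ * x.1.1) ^ 2 + x.1.2 ^ 2) - Real.sqrt ((γ * x.2.1) ^ 2 + x.2.2 ^ 2)| < δ} with hEdef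
  have hR : Continuous fun p : ℝ × ℝ => Real.sqrt ((γ * p.1) ^ 2 + p.2 ^ 2) := by fun_prop
  have hE : MeasurableSet E := by
    have h1 : IsClosed {x : (ℝ × ℝ) × (ℝ × ℝ) | |γ * x.1.1| ≤ γ} := isClosed_le (by fun_prop) continuous_const
    have h2 : IsOpen {x : (ℝ × ℝ) × (ℝ × ℝ) |
        |Real.sqrt ((γ * x.1.1) ^ 2 + x.1.2 ^ 2) - Real.sqrt ((γ * x.2.1) ^ 2 + x.2.2 ^ 2)| < δ} :=
      isOpen_lt (by fun_prop) continuous_const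
    have : E = {x : (ℝ × ℝ) × (ℝ × ℝ) | |γ * x.1.1| ≤ γ} ∩ {x : (ℝ × ℝ) × (ℝ × ℝ) |
        |Real.sqrt ((γ * x.1.1) ^ 2 + x.1.2 ^ 2) - Real.sqrt ((γ * x.2.1) ^ 2 + x.2.2 ^ 2)| < δ} := by
      ext x; simp [hEdef]
    rw [this]
    exact h1.measurableSet.inter h2.measurableSet
  rw [Measure.prod_apply_symm hE]
  have hpt : ∀ y : ℝ × ℝ, (μΓ₁.prod μl₁) ((fun x : ℝ × ℝ => (x, y)) ⁻¹' E) ≤ ENNReal.ofReal (64 * ρ₀ ^ 2 * δ) := by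
    intro y
    set r₂ := Real.sqrt ((γ * y.1) ^ 2 + y.2 ^ 2) with hr₂
    set a := max 0 (r₂ - δ) with hadef
    have ha : 0 ≤ a := le_max_left _ _
    have hsub : (fun x : ℝ × ℝ => (x, y)) ⁻¹' E ⊆ {p : ℝ × ℝ | |γ * p.1| ≤ γ ∧ a ≤ Real.sqrt ((γ * p.1) ^ 2 + p.2 ^ 2) ∧
        Real.sqrt ((γ * p.1) ^ 2 + p.2 ^ 2) ≤ a + 2 * δ} := by
      intro p hp
      simp only [mem_preimage, hEdef, mem_setOf_eq] at hp
      rcases hp with ⟨h1, h2⟩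
      rw [← hr₂] at h2
      have h2' := abs_lt.1 h2
      have hr1 : 0 ≤ Real.sqrt ((γ * p.1) ^ 2 + p.2 ^ 2) := Real.sqrt_nonneg _
      refine ⟨h1, ?_, ?_⟩
      · rw [hadef]
        exact max_le hr1 (by linarith)
      · rcases le_total 0 (r₂ - δ) with h | h
        · rw [hadef, max_eq_right h]; linarith
        · rw [hadef, max_eq_left h]; linarith
    calc (μΓ₁.prod μl₁) ((fun x : ℝ × ℝ => (x, y)) ⁻¹' E)
        ≤ (μΓ₁.prod μl₁) {p : ℝ × ℝ | |γ * p.1| ≤ γ ∧ a ≤ Real.sqrt ((γ * p.1) ^ 2 + p.2 ^ 2) ∧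
            Real.sqrt ((γ * p.1) ^ 2 + p.2 ^ 2) ≤ a + 2 * δ} := measure_mono hsub
      _ ≤ ENNReal.ofReal (32 * ρ₀ ^ 2 * (2 * δ)) := prod_dressedGapWindow_le hρ hμΓ₁ hμl₁ hγ ha (by linarith)
      _ = ENNReal.ofReal (64 * ρ₀ ^ 2 * δ) := by congr 1; ring
  calc ∫⁻ y, (μΓ₁.prod μl₁) ((fun x : ℝ × ℝ => (x, y)) ⁻¹' E) ∂(μΓ₂.prod μl₂)
      ≤ ∫⁻ _y, ENNReal.ofReal (64 * ρ₀ ^ 2 * δ) ∂(μΓ₂.prod μl₂) := lintegral_mono hpt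
    _ = ENNReal.ofReal (64 * ρ₀ ^ 2 * δ) := by rw [lintegral_const, measure_univ, mul_one]

end Literature.MathematicalPhysics.QuantumLattice.Imbrie2016
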